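import Summits.BirchSwinnertonDyer.BirchSwinnertonDyer.Theorems.PrintX8SharpFlatRankZeroRoad
import Literature.NumberTheory.EllipticCurves.Sprung2012.SharpFlatSelmerDualInvolutionTwistProofs
import Literature.NumberTheory.EllipticCurves.IwasawaAlgebraInvolutionFixedPrimesProofs
import HarnessLib

/-!
# Corner X8 (`p = 3`, good supersingular, `a_3 = ±3`), analytic rank `0`: Sprung's ♯/♭ Main Conjecture 7.21 at the
# pair IN PRINT KEYING (the `γ⁻¹`-keyed = contragredient dual `X^•(E/ℚ_∞)`) ⟹ `BSD(E,3)` — the rank-zero road of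
# `PrintX8SharpFlatRankZeroRoad.lean` transported along the `ι`-twist dictionary (cell `bsd-ssimc`, width seat
# `cruxlead-stmt-BirchSwinnertonDyer-19875-w3` gen 10; route-independent helper, theses-cone clean; pre-birth closer of
# the twin route `PrintX8VSC`'s support `RankZeroLinkOfPrintX8Contra`)

PARTITION (D-0054(2)): corner X8 = K3 row A8, the cells `r_an = 0`; proves the CLASS ROAD «♯/♭ main conjecture at
`(E,3)`, stated for the PRINT-KEYED dual, ⟹ `BSDp W 3`» WITHOUT any image hypothesis; closes NONE by itself (the main
conjecture at `a_3 = ±3` is OPEN in print); 0 census cells move; BSD is not proved by any of this. Beyond-print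
theorem: NO (Sprung, Adv. Math. 449 (2024) §5.2, Proof of Thm. 5.3, read for the printed keying `𝒳^{♯/♭ *} = X^•(γ⁻¹)`
of Sprung, J. Number Theory 132 (2012) §7.5 l.1).

## Why this file (the consumer)

The twin route `PrintX8VSC` (director-bsd (267)(B)/(288)(a); package `pub/bsd-print-x8/bsd-print-x8-plan/twinC-g33/`, v2.1)
re-keys every Selmer-side object of `PrintX8VS` as PRINTED: its main-conjecture node `SharpFlatMainConjectureX8Contra`
quantifies over `D : SharpFlatSelmerDualData W κ γ⁻¹ …` (the contragredient ♯/♭ dual), and its rank-zero link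
`RankZeroLinkOfPrintX8Contra := PublishedInputsX8Contra → RankEqAnalyticRankLeOne → SharpFlatMainConjectureX8Contra →
∀ X8 pairs of analytic rank 0, Typed.MissingPPartAt W p` is a SUPPORT item («port of p52695x, the constant term of
`char X^•` is `ι`-invariant, so the `γ⁻¹` key changes one rewrite», README §Items). This file is that port, landed
before birth against the INLINED bodies (no route file imported), so that the post-birth closer is a projection.

## The one rewrite, precisely (referee N-287b: the `γ`-universal fact `lem59AllN…` is instantiated AT KEY `γ` only)

Given the print-keyed datum `D′` (key `γ⁻¹`) with `char D′.X = (gen)`, `ι_ℚ gen = ϖ · ι_ℚ L^•` (`ι_ℚ` = the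
coefficient embedding `iwasawaToPowerSeries`, NOT the involution), take ANY tree-keyed datum `D` (key `γ`) of the same
`Sel^•`: by the dictionary `sharpFlatSelmerDualData_charIdeal_inv_eq` (`char D′.X = ι(char D.X)`, `ι` the Iwasawa
involution, an involution: `invol_invol`) one gets `char D.X = (ι gen)`; `D.X` is finitely generated torsion by Sprung's
Thm. 7.14 (keying-immune named fact, instantiated at key `γ`); Sprung 2024 Lemmas 5.5–5.9 (`lem59AllN_…`, a `γ`-keyed
named fact) are instantiated AT KEY `γ` on `(D, ι gen)` and give the Euler-characteristic identity for `(ι gen)(0)`;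
`(ι gen)(0) = gen(0)` (`IwasawaAlgebra.constantCoeff_invol`); and the b2b engine
`SignedDatum.bsdp_iff_charIdealEq_of_analyticRank_eq_zero` is fed the datum `(ι gen, ι(w·L^•), 1)` — its interpolation
clause mentions only the constant term of the second entry (transported by `constantCoeff_invol` from
`exists_units_interpolation_chromaticL`), and `(ι gen) = (ι L^•)` because `ϖ ∈ ℤ_3^×` (`X8_norm_periodRatio_eq_one`).

## What this file proves (all modulo PUBLISHED named facts, displayed)

* `X8.bsdp_of_charIdeal_eq_contra_of_analyticRank_eq_zero` — per pair, one admissible colour, from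
  `char D′.X = (gen)`, `ι_ℚ gen = ϖ · ι_ℚ L^•` for a PRINT-KEYED `D′`;
* `X8.bsdp_of_sprungSharpFlatMainConjectureContra_of_analyticRank_eq_zero` — per pair, from the print-keyed main
  conjecture body at the pair (all admissible colours; the body of `PrintX8VSC.SharpFlatMainConjectureX8Contra`
  instantiated at `(W, p)`, INLINED);
* `X8.missingPPartAt_of_sprungSharpFlatMainConjectureContra_of_analyticRank_eq_zero` — typed currency;
* `missingPPartAt_rankZero_of_mainConjectureContra` — CLASS form = the body of `RankZeroLinkOfPrintX8Contra` with the
  seven conjuncts of `PublishedInputsX8Contra` displayed one by one (`thm716_…_contra` is idle here and not taken).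

HONEST STATUS: CONDITIONAL on the displayed named facts (all PUBLISHED) and on the OPEN main conjecture taken as
hypothesis; closes nothing; X8 stays a corner; no summit statement is proved. Not a new engine.

References: [Sprung2024] Thm. 5.3 (p. 38), §5.2 Lemmas 5.5–5.9 and Proof of Thm. 5.3 (pp. 39–41); [Sprung2012] Thm. 2.2,
Prop. 6.14, Def. 7.11, Thm. 7.14, Main Conj. 7.21 (pp. 1487–1505), §7.5; [Sprung2017] Thm. 1.12, Cor. 4.11;
[GreenbergLNM1716] §1 (p. 60) (`S^ι`); [MazurTateTeitelbaum1986Invent] Ch. I §17 (the involution); [Mazur1978] Cor. 4.1;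
[GreenbergVatsal2000] §3 Rem. 3.4; [Miller2011LMS] Def. 1.1; tree: `PrintX8SharpFlatRankZeroRoad.lean` (the `γ`-keyed road),
`Sprung2012/SharpFlatSelmerDualInvolutionTwistProofs.lean` (the dictionary).
-/

set_option autoImplicit false
-- justification: the mandated namespace `Summit.BirchSwinnertonDyer.BirchSwinnertonDyer.Theorems`
-- (single-conjunct summit, Sub = Summit) repeats a segment by design (D-0017).
set_option linter.dupNamespace false

noncomputable section

namespace Summit.BirchSwinnertonDyer.BirchSwinnertonDyer.Theorems.X8MainConjectureRoadContra

open scoped Classical NumberField MatrixGroups ModularForm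
open NumberField IsDedekindDomain WeierstrassCurve CongruenceSubgroup
  Literature.NumberTheory.EllipticCurves Literature.NumberTheory.EllipticCurves.ModularForms
  Literature.NumberTheory.EllipticCurves.Rank1Residual
  Literature.NumberTheory.EllipticCurves.Rank1Residual.Typed
  Literature.NumberTheory.EllipticCurves.Sprung2017 Literature.NumberTheory.EllipticCurves.Sprung2012
  Literature.NumberTheory.EllipticCurves.Sprung2024
  Literature.NumberTheory.EllipticCurves.ZpExtension
  Literature.NumberTheory.EllipticCurves.IwasawaAlgebra
  Summit.BirchSwinnertonDyer.Rank1Residual.Supersingular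
  Summit.BirchSwinnertonDyer.BirchSwinnertonDyer.Theorems.X8MainConjectureRoad

/-! ### §0. The dictionary step: `char D′.X = (gen)` for the print-keyed dual ⟹ `char D.X = (ι gen)` for the tree-keyed one -/

/-- **`char X^•(γ⁻¹) = (gen) ⟹ char X^•(γ) = (ι gen)`** for ANY tree-keyed `D` (key `γ`) and ANY print-keyed `D′`
(key `γ⁻¹`) of the same `Sel^•(E/K_∞)`: the dictionary `char D′.X = ι(char D.X)` (`sharpFlatSelmerDualData_charIdeal_inv_eq`)
read backwards through `ι ∘ ι = id`. [cite: GreenbergLNM1716, §1 (p. 60)] [cite: Washington1997, §13.2] -/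
theorem charIdeal_eq_span_invol_of_inv {K : Type} [Field K] [NumberField K] {W : WeierstrassCurve K} {p : ℕ}
    [Fact p.Prime] {κ : ZpExtension K p} {γ : Field.absoluteGaloisGroup K} {E : Type} [Field E] [Algebra K E]
    {ι : AlgebraicClosure K →ₐ[K] AlgebraicClosure E} {ap : ℤ} {g : Field.absoluteGaloisGroup E}
    {c : ℕ → localPoints W E} {col : Chroma}
    (D : SharpFlatSelmerDualData W κ γ ι ap g c col) (D' : SharpFlatSelmerDualData W κ γ⁻¹ ι ap g c col)
    {gen : IwasawaAlgebra p} (hchar : D'.charIdeal = Ideal.span {gen}) :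
    D.charIdeal = Ideal.span {invol p gen} := by
  have h1 : D'.charIdeal = D.charIdeal.map (invol p).toRingHom := sharpFlatSelmerDualData_charIdeal_inv_eq D D'
  have h2 : (D.charIdeal.map (invol p).toRingHom).map (invol p).toRingHom = D.charIdeal := by
    rw [Ideal.map_map]
    have hcomp : ((invol p).toRingHom).comp (invol p).toRingHom = RingHom.id (IwasawaAlgebra p) :=
      RingHom.ext fun f => invol_invol p f
    rw [hcomp, Ideal.map_id]
  rw [← h2, ← h1, hchar, Ideal.map_span, Set.image_singleton]
  rfl

/-! ### §1. Per pair, one admissible colour: Main Conj. 7.21 for `•` (PRINT keying) with `L^• ≠ 0` ⟹ `BSD(E,3)` -/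

/-- **X8 ∧ `r_an = 0`, ANY image, PRINT KEYING: the ♯/♭ main conjecture for ONE admissible colour, stated for the
contragredient dual `X^•(γ⁻¹)`, gives `BSD(E,3)`.** For an X8 pair of analytic rank `0`, the cyclotomic setting `(κ, γ)`,
the place `v ∋ 3` with local lift `g`, a Honda system `(cneg, c)`, the newform `f` of `W` with `ϖ·Ω_E = Ω⁺_f`, a Sprung pair
`(L♯, L♭)` and a colour `•` with `L^• ≠ 0`: if for a PRINT-KEYED dual datum `D′` (key `γ⁻¹`, Sprung 2012 §7.5 `𝒳^{•*}`)
`char D′.X = (gen)` with `ι_ℚ gen = ϖ · ι_ℚ L^•`, then `BSDp W 3` — granted BY NAME Sprung 2012 Thm. 7.14 (`h714`), Sprung 2024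
Lemmas 5.5–5.9 at all levels (`h59`), the period unit at `3` (`h3`), GZK, modularity. Proof = the `γ`-keyed road
`X8.bsdp_of_charIdeal_eq_of_analyticRank_eq_zero` run on the `ι`-TWIST: the real tree-keyed `D` has `char D.X = (ι gen)`
(§0), `h714`/`h59` are instantiated AT KEY `γ` on `(D, ι gen)`, `(ι gen)(0) = gen(0)`, and the b2b engine
`SignedDatum.bsdp_iff_charIdealEq_of_analyticRank_eq_zero` is fed `(ι gen, ι(w·L^•), 1)` with `(ι gen) = (ι L^•)` (`ϖ ∈ ℤ_3^×`).
PER PAIR; conditional; closes nothing. [cite: Sprung2024, Thm. 5.3 (p. 38) and §5.2 Lemmas 5.5–5.9, Proof of Thm. 5.3 (pp. 39–41)]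
[cite: Sprung2012, Thm. 7.14 (p. 1504), Main Conj. 7.21 (p. 1505) and §7.5] [cite: Sprung2017, Cor. 4.11]
[cite: GreenbergLNM1716, §1 (p. 60)] [cite: Miller2011LMS, Def. 1.1] -/
theorem X8.bsdp_of_charIdeal_eq_contra_of_analyticRank_eq_zero
    (h714 : thm714_sharpFlatSelmerDual_finite_torsion)
    (h59 : lem59AllN_sharpFlatCharValue_rankZero)
    (h3 : realPeriodRat_eq_unit_mul_plusPeriod_three)
    (hGZK : rank_eq_analyticRank_of_analyticRank_le_one) (hmod : hasEntireLFunction_rat)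
    (W : WeierstrassCurve ℚ) [W.IsElliptic] [W.IsGloballyMinimal] (p : ℕ) [Fact p.Prime]
    (hX : ClassX8 W p) (h0 : W.analyticRank = 0)
    {κ : ZpExtension ℚ p} {γ : Field.absoluteGaloisGroup ℚ} (hκ : κ.IsCyclotomic)
    (hγ : κ.IsTopGenerator γ) (hγ' : IsCyclotomicVariable p γ)
    {v : HeightOneSpectrum (𝓞 ℚ)} (hv : (p : 𝓞 ℚ) ∈ v.asIdeal)
    {g : Field.absoluteGaloisGroup (v.adicCompletion ℚ)}
    (hg : κ.IsTopGenerator (resGalOfEmb (closureEmb (K := ℚ) (v.adicCompletion ℚ)) g))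
    {cneg : localPoints W (v.adicCompletion ℚ)} {c : ℕ → localPoints W (v.adicCompletion ℚ)}
    (hc : IsHondaSystem κ (closureEmb (K := ℚ) (v.adicCompletion ℚ)) W (W.frobeniusTrace p) g cneg c)
    {N : ℕ} [NeZero N] {f : CuspForm (Gamma0 N) 2} (hf : IsNewformOf W f)
    {ϖ : ℚ} (hϖ : (ϖ : ℝ) * W.realPeriodRat = plusPeriod f)
    {Lsharp Lflat : IwasawaAlgebra p} (hSP : IsSprungPair f p (W.frobeniusTrace p) Lsharp Lflat)
    (col : Chroma) (hcol : chromaticL col Lsharp Lflat ≠ 0)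
    (D' : SharpFlatSelmerDualData W κ γ⁻¹ (closureEmb (K := ℚ) (v.adicCompletion ℚ))
      (W.frobeniusTrace p) g c col)
    (gen : IwasawaAlgebra p) (hchar : D'.charIdeal = Ideal.span {gen})
    (hι : iwasawaToPowerSeries p gen =
      PowerSeries.C (ϖ : ℚ_[p]) * iwasawaToPowerSeries p (chromaticL col Lsharp Lflat)) :
    BSDp W p := by
  have hp3 : p = 3 := hX.1
  subst hp3
  have hp2 : (3 : ℕ) ≠ 2 := by decide
  have hpP : (3 : ℕ).Prime := Fact.out
  have hgood : W.HasGoodReductionAtPrime 3 := hX.2.1.1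
  have hdvd : ((3 : ℕ) : ℤ) ∣ W.frobeniusTrace 3 := hX.2.1.2
  have hirr : W.HasIrreducibleModPGaloisRep 3 := ClassX8.irr W 3 hX
  have hL : W.entireLFunction 1 ≠ 0 := (W.analyticRank_eq_zero_iff_holds (hmod W)).1 h0
  -- the REAL tree-keyed dual `D` (key `γ`) of the same `Sel^•`, finitely generated torsion by Thm. 7.14 AT KEY `γ`
  let D := sharpFlatSelmerDualData W κ (closureEmb (K := ℚ) (v.adicCompletion ℚ))
    (W.frobeniusTrace 3) g c col hγ
  obtain ⟨hfinD, htorD⟩ :=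
    h714 W 3 hp2 hgood hdvd f hf κ γ hκ hγ hγ' v hv g hg cneg c hc col Lsharp Lflat hSP hcol D
  haveI := hfinD
  -- §0: `char D.X = (ι gen)`
  have hcharD : D.charIdeal = Ideal.span {invol 3 gen} := charIdeal_eq_span_invol_of_inv D D' hchar
  -- (K•) for `ι gen`, by name, AT KEY `γ` (Sprung 2024 Lemmas 5.5–5.9, all levels)
  have hK : (⟨invol 3 gen, 0, 0⟩ : SignedDatum W 3).EulerCharacteristic := fun hfin =>
    h59 W 3 hp2 hgood hdvd hL κ γ hκ hγ hγ' v hv g hg cneg c hc col D htorD (invol 3 gen) hcharD hfin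
  -- `ϖ ∈ ℤ_3^×`, so `gen = ϖ · L^•` in `Λ` and `ι gen = ϖ · ι L^•`
  have hϖ1 : ‖(ϖ : ℚ_[3])‖ = 1 := X8_norm_periodRatio_eq_one h3 W 3 hX hf hϖ
  obtain ⟨hspanϖ, hιϖ⟩ := span_C_units_mul_eq (PadicInt.mkUnits hϖ1) (chromaticL col Lsharp Lflat)
  have hgen_eq : gen = PowerSeries.C ((PadicInt.mkUnits hϖ1 : ℤ_[3]ˣ) : ℤ_[3]) *
      chromaticL col Lsharp Lflat := by
    apply iwasawaToPowerSeries_injective 3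
    rw [hι, hιϖ, PadicInt.mkUnits_eq]
  have hιgen : invol 3 gen = PowerSeries.C ((PadicInt.mkUnits hϖ1 : ℤ_[3]ˣ) : ℤ_[3]) *
      invol 3 (chromaticL col Lsharp Lflat) := by
    rw [hgen_eq, map_mul, invol_C]
  -- unit normalisation of the real `L^•` (interpolation constant `1`), transported along `ι` by `(ι x)(0) = x(0)`
  obtain ⟨w, hP⟩ := exists_units_interpolation_chromaticL W 3 hp2 hgood hf (h3 W hgood hirr f hf) hSP col
    (ClassX8.not_dvd_chromaticConst' W 3 hX col) (invol 3 gen)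
  have hP' : (⟨invol 3 gen, invol 3 (PowerSeries.C (w : ℤ_[3]) * chromaticL col Lsharp Lflat), 1⟩ :
      SignedDatum W 3).Interpolation := by
    obtain ⟨t, ht, hLt⟩ := hP
    refine ⟨t, ht, ?_⟩
    change ((PowerSeries.constantCoeff (invol 3 (PowerSeries.C (w : ℤ_[3]) * chromaticL col Lsharp Lflat)) :
        ℤ_[3]) : ℚ_[3]) = ((1 : ℕ) : ℚ_[3]) * ((t : ℚ) : ℚ_[3])
    rw [constantCoeff_invol]
    exact hLt
  -- `(ι gen) = (ι L^•) = (ι (w · L^•))`: the two spans agree, whence the divisibility the engine wants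
  have hspan : Ideal.span ({invol 3 gen} : Set (IwasawaAlgebra 3)) =
      Ideal.span {invol 3 (PowerSeries.C (w : ℤ_[3]) * chromaticL col Lsharp Lflat)} := by
    rw [hιgen, map_mul, invol_C, (span_C_units_mul_eq (PadicInt.mkUnits hϖ1) _).1, (span_C_units_mul_eq w _).1]
  have hU : invol 3 gen ∣ invol 3 (PowerSeries.C (w : ℤ_[3]) * chromaticL col Lsharp Lflat) :=
    (Ideal.span_singleton_eq_span_singleton.mp hspan).dvd
  exact (SignedDatum.bsdp_iff_charIdealEq_of_analyticRank_eq_zero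
    (⟨invol 3 gen, invol 3 (PowerSeries.C (w : ℤ_[3]) * chromaticL col Lsharp Lflat), 1⟩ : SignedDatum W 3)
    hGZK hirr hL hpP.not_dvd_one hK hP' hU).mpr hspan

/-! ### §2. Per pair: the print-keyed main conjecture body at `(W, p)` (all admissible colours) ⟹ `BSD(E,3)` -/

/-- **X8 ∧ `r_an = 0`, ANY image, ANY conductor: Sprung's ♯/♭ Main Conjecture 7.21 at `(E, 3)` in PRINT keying — the body
of `PrintX8VSC.SharpFlatMainConjectureX8Contra` instantiated at the pair (every admissible colour, every cyclotomic/Honda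
frame, every newform/period/Sprung pair, EVERY `γ⁻¹`-keyed dual `D`) — gives Miller's `BSD(E,3)`**, granted BY NAME
`exists_isNewformOf` (BCDT), Sprung 2012 Thm. 2.2 / 7.14, Sprung 2024 Lemmas 5.5–5.9 (all levels), the period unit at `3`, GZK
and modularity. The frame is built as in the `γ`-road (`exists_isCyclotomic_isTopGenerator_isCyclotomicVariable_holds`, a place
above `3`, a local lift, a Honda system), an admissible colour exists (Prop. 6.14, `IsSprungPair.exists_chromaticL_ne_zero`) for
the Sprung pair of Sprung 2017 Thm. 1.12, and a print-keyed dual datum exists outright (`nonempty_sharpFlatSelmerDualData'` at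
key `γ⁻¹`). Conditional; closes nothing. [cite: Sprung2024, Thm. 5.3 (p. 38) and §5.2 (pp. 39–41)]
[cite: Sprung2012, Thm. 2.2, Prop. 6.14, Thm. 7.14, Main Conj. 7.21 and §7.5] [cite: Sprung2017, Thm. 1.12] [cite: Miller2011LMS, Def. 1.1] -/
theorem X8.bsdp_of_sprungSharpFlatMainConjectureContra_of_analyticRank_eq_zero
    (hmodf : exists_isNewformOf) (h22 : thm22_exists_isHondaSystem)
    (h714 : thm714_sharpFlatSelmerDual_finite_torsion)
    (h59 : lem59AllN_sharpFlatCharValue_rankZero)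
    (h3 : realPeriodRat_eq_unit_mul_plusPeriod_three)
    (hGZK : rank_eq_analyticRank_of_analyticRank_le_one) (hmod : hasEntireLFunction_rat)
    (W : WeierstrassCurve ℚ) [W.IsElliptic] [W.IsGloballyMinimal] (p : ℕ) [Fact p.Prime]
    (hX : ClassX8 W p) (h0 : W.analyticRank = 0)
    (hMC : ∀ (col : Chroma) (κ : ZpExtension ℚ p) (γ : Field.absoluteGaloisGroup ℚ),
      κ.IsCyclotomic → κ.IsTopGenerator γ → IsCyclotomicVariable p γ →
      ∀ (v : HeightOneSpectrum (𝓞 ℚ)), (p : 𝓞 ℚ) ∈ v.asIdeal →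
      ∀ (g : Field.absoluteGaloisGroup (v.adicCompletion ℚ)),
        κ.IsTopGenerator (resGalOfEmb (closureEmb (K := ℚ) (v.adicCompletion ℚ)) g) →
      ∀ (cneg : localPoints W (v.adicCompletion ℚ)) (c : ℕ → localPoints W (v.adicCompletion ℚ)),
        IsHondaSystem κ (closureEmb (K := ℚ) (v.adicCompletion ℚ)) W (W.frobeniusTrace p) g cneg c →
      ∀ (N : ℕ) (_ : NeZero N) (f : CuspForm (Gamma0 N) 2) (ϖ : ℚ) (Lsharp Lflat : IwasawaAlgebra p),
        IsNewformOf W f → (ϖ : ℝ) * W.realPeriodRat = plusPeriod f →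
        IsSprungPair f p (W.frobeniusTrace p) Lsharp Lflat → chromaticL col Lsharp Lflat ≠ 0 →
      ∀ (D : SharpFlatSelmerDualData W κ γ⁻¹ (closureEmb (K := ℚ) (v.adicCompletion ℚ))
          (W.frobeniusTrace p) g c col),
        Module.IsTorsion (IwasawaAlgebra p) D.X ∧
        ∃ gen : IwasawaAlgebra p, D.charIdeal = Ideal.span {gen} ∧
          iwasawaToPowerSeries p gen =
            PowerSeries.C (ϖ : ℚ_[p]) * iwasawaToPowerSeries p (chromaticL col Lsharp Lflat)) :
    BSDp W p := by
  have hp3 : p = 3 := hX.1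
  subst hp3
  have hp2 : (3 : ℕ) ≠ 2 := by decide
  have hgood : W.HasGoodReductionAtPrime 3 := hX.2.1.1
  have hdvd : ((3 : ℕ) : ℤ) ∣ W.frobeniusTrace 3 := hX.2.1.2
  have hirr : W.HasIrreducibleModPGaloisRep 3 := ClassX8.irr W 3 hX
  -- the newform, the Sprung pair (Sprung 2017 Thm. 1.12) and an admissible colour (Prop. 6.14)
  haveI : NeZero (W.conductorNorm ℤ) := ⟨(W.conductorNorm_pos_holds).ne'⟩
  obtain ⟨f, hf⟩ := hmodf W
  obtain ⟨Lsharp, Lflat, hSP⟩ :=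
    thm112_exists_isSprungPair_holds (W := W) (f := f) (p := 3) (by decide) hf hgood hdvd
  obtain ⟨col, hcol⟩ := hSP.exists_chromaticL_ne_zero hf hgood
  -- `ϖ := u⁻¹` from the period fact at `3`
  obtain ⟨u, hu1, hΩu⟩ := h3 W hgood hirr f hf
  have hu0 : u ≠ 0 := by
    rintro rfl
    rw [Rat.cast_zero, norm_zero] at hu1
    exact zero_ne_one hu1
  set ϖ : ℚ := u⁻¹ with hϖ_def
  have hϖ : (ϖ : ℝ) * W.realPeriodRat = plusPeriod f := by
    rw [hΩu, hϖ_def, Rat.cast_inv, ← mul_assoc, inv_mul_cancel₀ (Rat.cast_ne_zero.mpr hu0), one_mul]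
  -- the cyclotomic setting, the place above `3`, the local lift, a Honda system (Thm. 2.2)
  obtain ⟨κ, hκ, γ, hγ, hγ'⟩ := exists_isCyclotomic_isTopGenerator_isCyclotomicVariable_holds 3
  obtain ⟨v, hv⟩ :=
    Literature.NumberTheory.NumberFields.RingOfIntegers.exists_heightOneSpectrum_natCast_mem ℚ
      (p := 3) (by norm_num)
  obtain ⟨g, hg⟩ := hκ.exists_isTopGenerator_resGalOfEmb_adicCompletion v hv
  obtain ⟨cneg, c, hc⟩ := h22 W 3 hp2 hgood hdvd κ γ hκ hγ hγ' v hv g hg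
  -- a PRINT-KEYED dual datum (key `γ⁻¹`) and the main conjecture at the pair for `•`
  obtain ⟨D'⟩ := nonempty_sharpFlatSelmerDualData' W κ (closureEmb (K := ℚ) (v.adicCompletion ℚ))
    (W.frobeniusTrace 3) g c col γ⁻¹
  obtain ⟨-, gen, hchar, hι⟩ :=
    hMC col κ γ hκ hγ hγ' v hv g hg cneg c hc (W.conductorNorm ℤ) inferInstance f ϖ Lsharp Lflat hf hϖ hSP hcol D'
  exact X8.bsdp_of_charIdeal_eq_contra_of_analyticRank_eq_zero h714 h59 h3 hGZK hmod W 3 hX h0 hκ hγ hγ' hv hg hc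
    hf hϖ hSP col hcol D' gen hchar hι

/-- **Typed currency**: X8 ∧ `r_an = 0`, any image, the print-keyed main conjecture body at the pair ⟹ `MissingPPartAt W 3`
(`ord_3 #Ш_an = ord_3 #Ш`), same named facts. [cite: Sprung2024, Thm. 5.3 (p. 38)] [cite: Miller2011LMS, Def. 1.1] -/
theorem X8.missingPPartAt_of_sprungSharpFlatMainConjectureContra_of_analyticRank_eq_zero
    (hmodf : exists_isNewformOf) (h22 : thm22_exists_isHondaSystem)
    (h714 : thm714_sharpFlatSelmerDual_finite_torsion)
    (h59 : lem59AllN_sharpFlatCharValue_rankZero)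
    (h3 : realPeriodRat_eq_unit_mul_plusPeriod_three)
    (hGZK : rank_eq_analyticRank_of_analyticRank_le_one) (hmod : hasEntireLFunction_rat)
    (W : WeierstrassCurve ℚ) [W.IsElliptic] [W.IsGloballyMinimal] (p : ℕ) [Fact p.Prime]
    (hX : ClassX8 W p) (h0 : W.analyticRank = 0)
    (hMC : ∀ (col : Chroma) (κ : ZpExtension ℚ p) (γ : Field.absoluteGaloisGroup ℚ),
      κ.IsCyclotomic → κ.IsTopGenerator γ → IsCyclotomicVariable p γ →
      ∀ (v : HeightOneSpectrum (𝓞 ℚ)), (p : 𝓞 ℚ) ∈ v.asIdeal →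
      ∀ (g : Field.absoluteGaloisGroup (v.adicCompletion ℚ)),
        κ.IsTopGenerator (resGalOfEmb (closureEmb (K := ℚ) (v.adicCompletion ℚ)) g) →
      ∀ (cneg : localPoints W (v.adicCompletion ℚ)) (c : ℕ → localPoints W (v.adicCompletion ℚ)),
        IsHondaSystem κ (closureEmb (K := ℚ) (v.adicCompletion ℚ)) W (W.frobeniusTrace p) g cneg c →
      ∀ (N : ℕ) (_ : NeZero N) (f : CuspForm (Gamma0 N) 2) (ϖ : ℚ) (Lsharp Lflat : IwasawaAlgebra p),
        IsNewformOf W f → (ϖ : ℝ) * W.realPeriodRat = plusPeriod f →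
        IsSprungPair f p (W.frobeniusTrace p) Lsharp Lflat → chromaticL col Lsharp Lflat ≠ 0 →
      ∀ (D : SharpFlatSelmerDualData W κ γ⁻¹ (closureEmb (K := ℚ) (v.adicCompletion ℚ))
          (W.frobeniusTrace p) g c col),
        Module.IsTorsion (IwasawaAlgebra p) D.X ∧
        ∃ gen : IwasawaAlgebra p, D.charIdeal = Ideal.span {gen} ∧
          iwasawaToPowerSeries p gen =
            PowerSeries.C (ϖ : ℚ_[p]) * iwasawaToPowerSeries p (chromaticL col Lsharp Lflat)) :
    MissingPPartAt W p := by
  haveI : Finite W.sha := (hGZK W (by omega)).2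
  exact missingPPartAt_of_bsdp W p
    (X8.bsdp_of_sprungSharpFlatMainConjectureContra_of_analyticRank_eq_zero hmodf h22 h714 h59 h3 hGZK hmod
      W p hX h0 hMC)

/-! ### §3. Class form: the body of `PrintX8VSC.RankZeroLinkOfPrintX8Contra` with the published inputs displayed -/

/-- **The rank-zero X8 cells BY NAME, print keying (class form, no route file imported)** — the body of the twin route's
support `RankZeroLinkOfPrintX8Contra` with the conjuncts of `PublishedInputsX8Contra` it uses displayed one by one
(`exists_isNewformOf`, `thm22_exists_isHondaSystem`, `thm714_…`, `lem59AllN_…`, the period unit at `3`, `hasEntireLFunction_rat`;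
`thm716_…_contra` is idle for the rank-zero link), GZK, and the print-keyed main conjecture on class X8 at analytic rank `≤ 1`
(the body of `SharpFlatMainConjectureX8Contra`, inlined) as the hypothesis: at EVERY X8 pair of analytic rank `0`, the typed
output `MissingPPartAt W p`. Post-birth the item's closer is the projection
`fun hPub hGZK hMC => missingPPartAt_rankZero_of_mainConjectureContra hPub.1 hPub.2.1 hPub.2.2.1 hPub.2.2.2.2.1 hPub.2.2.2.2.2.1 hGZK hPub.2.2.2.2.2.2 hMC`.
Conditional; closes nothing here. [cite: Sprung2024, Thm. 5.3 (p. 38) and §5.2 (pp. 39–41)] [cite: Sprung2012, Main Conj. 7.21 (p. 1505) and §7.5]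
[cite: Miller2011LMS, Def. 1.1] -/
theorem missingPPartAt_rankZero_of_mainConjectureContra
    (hmodf : exists_isNewformOf) (h22 : thm22_exists_isHondaSystem)
    (h714 : thm714_sharpFlatSelmerDual_finite_torsion)
    (h59 : lem59AllN_sharpFlatCharValue_rankZero)
    (h3 : realPeriodRat_eq_unit_mul_plusPeriod_three)
    (hGZK : rank_eq_analyticRank_of_analyticRank_le_one) (hmod : hasEntireLFunction_rat)
    (hMC : ∀ (W : WeierstrassCurve ℚ) [W.IsElliptic] [W.IsGloballyMinimal] (p : ℕ) [Fact p.Prime],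
      ClassX8 W p → W.analyticRank ≤ 1 →
      ∀ (col : Chroma) (κ : ZpExtension ℚ p) (γ : Field.absoluteGaloisGroup ℚ),
      κ.IsCyclotomic → κ.IsTopGenerator γ → IsCyclotomicVariable p γ →
      ∀ (v : HeightOneSpectrum (𝓞 ℚ)), (p : 𝓞 ℚ) ∈ v.asIdeal →
      ∀ (g : Field.absoluteGaloisGroup (v.adicCompletion ℚ)),
        κ.IsTopGenerator (resGalOfEmb (closureEmb (K := ℚ) (v.adicCompletion ℚ)) g) →
      ∀ (cneg : localPoints W (v.adicCompletion ℚ)) (c : ℕ → localPoints W (v.adicCompletion ℚ)),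
        IsHondaSystem κ (closureEmb (K := ℚ) (v.adicCompletion ℚ)) W (W.frobeniusTrace p) g cneg c →
      ∀ (N : ℕ) (_ : NeZero N) (f : CuspForm (Gamma0 N) 2) (ϖ : ℚ) (Lsharp Lflat : IwasawaAlgebra p),
        IsNewformOf W f → (ϖ : ℝ) * W.realPeriodRat = plusPeriod f →
        IsSprungPair f p (W.frobeniusTrace p) Lsharp Lflat → chromaticL col Lsharp Lflat ≠ 0 →
      ∀ (D : SharpFlatSelmerDualData W κ γ⁻¹ (closureEmb (K := ℚ) (v.adicCompletion ℚ))
          (W.frobeniusTrace p) g c col),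
        Module.IsTorsion (IwasawaAlgebra p) D.X ∧
        ∃ gen : IwasawaAlgebra p, D.charIdeal = Ideal.span {gen} ∧
          iwasawaToPowerSeries p gen =
            PowerSeries.C (ϖ : ℚ_[p]) * iwasawaToPowerSeries p (chromaticL col Lsharp Lflat)) :
    ∀ (W : WeierstrassCurve ℚ) [W.IsElliptic] [W.IsGloballyMinimal] (p : ℕ) [Fact p.Prime],
      ClassX8 W p → W.analyticRank = 0 → MissingPPartAt W p :=
  fun W _ _ p _ hX h0 =>
    X8.missingPPartAt_of_sprungSharpFlatMainConjectureContra_of_analyticRank_eq_zero hmodf h22 h714 h59 h3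
      hGZK hmod W p hX h0 (hMC W p hX (by omega))

end Summit.BirchSwinnertonDyer.BirchSwinnertonDyer.Theorems.X8MainConjectureRoadContra

end
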